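/-
Copyright: lit-balaban Phase-2 proof seat p34 (gen 18).  Statement-level skeleton of a published paper; no proof claims beyond what the
kernel checks below.
-/
import Literature.MathematicalPhysics.QuantumFieldTheory.BalabanImbrieJaffe1984to88.BIJ88NeumannNoZeroModesTorus
import Literature.MathematicalPhysics.QuantumFieldTheory.BalabanImbrieJaffe1984to88.BIJ85BlockAveragingIneq

/-!
# [BalabanImbrieJaffe1988] (2.27)/(2.30) p. 263 / [Balaban1983RegularityDecay] (1.3)/(1.6), (1.10) — **THE FREE NEUMANN LAPLACIAN `−Δ^N_Ω` OF A
# REGION `Ω` OF THE FINE TORUS AS A REAL MATRIX, ITS MASSIVE RESOLVENT `(s(−Δ^N_Ω) + 1)⁻¹` (minimum principle, comparison, row sums), AND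
# THE REFLECTING LAZY WALK `P = 1 − (8D)⁻¹(−Δ^N_Ω)`: THE WEIGHTED `ℓ²` (DAVIES) STEP AND THE WEIGHTED `ℓ¹` STEP** — engine file 1 of 3 behind
# the `k`-uniform SUP-NORM (operator-form) decay of the REGION Neumann propagators `G_k(Ω,u)` at non-flat small fields on an ARBITRARY union of
# `k`-blocks (the region analogue of p27's box engine `BIJ88FreeNeumannResolventBox`, whose multiscale input has no analogue for general `Ω`)

T. Bałaban, J. Imbrie, A. Jaffe, *Effective action and cluster properties of the abelian Higgs model*, Commun. Math. Phys. **114** (1988)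
257–315 [BalabanImbrieJaffe1988], Sect. 2 p. 262–263 [PDF 6–7], (2.27)/(2.30); [6] = T. Bałaban, *Regularity and decay of lattice Green's
functions*, Commun. Math. Phys. **89** (1983) 571–597 [Balaban1983RegularityDecay], (1.3)/(1.6) p. 572, (1.10) p. 573, (2.44) p. 584; [I] = T. Bałaban,
J. Imbrie, A. Jaffe, *Renormalization of the Higgs model: minimizers, propagators and the stability of mean field theory*, Commun. Math. Phys.
**97** (1985) 299–329 [BalabanImbrieJaffe1985], §7.3 p. 326 [PDF 28].

statement-level skeleton of published theorems with citation tags; proofs where landed; nothing here is a claim about the Yang–Mills mass gap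

PDF held: `paper:balaban1988-cmp114-bij-abelian-higgs-effective-action` (journal page = PDF page + 256), p. 262–263 [PDF 6–7] re-read this
session (`lit read … --pages 6-8`); `paper:balaban1983-cmp89-regularity-decay` p. 572 [PDF 2] re-read for v1.1 ((1.3), (1.6); the tree's
`Balaban1983to89.B4BoxCov237` transcribes the same lines).

CITATION HEADER (lean-in-tree rule).  Part of the lit-balaban TYPED SKELETON (HOME `run/shared/lean/pub/lit-balaban/`), PHASE-2 proof seat
p34 gen 18 (unit `lit-balaban-p34-g18`; TAKING line HOME/STATUS.md 2026-08-23T04:22:50Z; free-target protocol G.5-34(d) — SOURCE: the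
owner's `HOME/lit-balaban-r18/C2S14-CLOSURE.md` v1.16s *"REMAINING NON-FLAT FRONT (α′) operator-form (H1.10) for general regions at small u
(kernel form: p34 v1.2 done)"*, i.e. p27 gen 34's HONEST SCOPE (ii) of `BIJ88NeumannPropagatorSmallFieldSupDecay` *"a general outer block union
Ω … remain displayed hypotheses of p31's file"*).  WHAT IS REPRODUCED: nothing printed is restated here — this file is an ENGINE (pure lattice
analysis, no gauge field) behind a located member of rows **C2.Eq2.30** (`HOME/lit-balaban-r18/ROWS-C2.md`, owner r18) and **C1.Eq7.3.1-7.3.2**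
(`HOME/lit-balaban-r15/ROWS-C1.md`, owner r15), namely the (1.10) VALUE member in OPERATOR form for p31's region propagators `gBox … Ω` on a
GENERAL `k`-block union `Ω` at non-flat small `u` (file 4, `BIJ88NeumannPropagatorSmallFieldRegionSup`).  Kind: TWO small definitions with body
(`bvec b = δ_{b₊} − δ_{b₋}` and `lapN Ω`, the free Neumann Laplacian of [6] (1.3) on the torus region, real matrix) + theorems; no
`Prop`-valued fact.

THE PRINTED TEXT (verbatim).  C2 p. 262–263 [PDF 6–7]: *"In the scalar field sector, we have the η-lattice propagators G_k(Ω,u) defined on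
subsets Ω ⊂ T_η with Neumann boundary conditions. … a straightforward application of the random walk expansion of [6] shows that
|(G_{k,loc}(u)f)(x)| ≦ ce^{−c dist(suppt f,x)}‖f‖_∞, (2.30)"*.  [6] p. 572 [PDF 2] (v1.1, re-read): *"Now the covariant Laplace operator
−Δ^{η,N}_{A,Ω} on a domain Ω with Neumann boundary conditions on ∂Ω is given by the following quadratic form defined on functions φ: Ω → R^N,
⟨φ,(−Δ^{η,N}_{A,Ω})φ⟩ = Σ_{b⊂Ω} η^d|(D^η_Aφ)(b)|² = Σ_{b⊂Ω} η^d|η^{−1}(U(A_b)φ(b₊) − φ(b₋))|², (1.3) where the summation is over the set of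
all bonds b = ⟨b₋, b₊⟩ with end-points b₋, b₊ in Ω"*; *"Our fundamental Green's function is a kernel of the operator
G_k(Ω, A) = (−Δ^{η,N}_{A,Ω} + m² + aP_k(A))^{−1}, (1.6) where m² ≥ 0 and a is a positive constant close to 1"* ((1.7) on the same page is
the REGULARITY CONDITION on `A`, not used here: `A = 0`).  C2 p. 266 [PDF 10]: *"We denote by X* the set of bonds with both endpoints in X"*
(r18's `starB`).

THE OBJECTS.  On the fine torus `T^{(0)} = Site P 0` of `Setup`, for a region `Ω` (any `Finset` of sites; a union of `k`-blocks in the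
applications): **`lapN Ω = Σ_{b∈Ω*} v_bv_bᵀ`**, `v_b = δ_{b₊} − δ_{b₋}` — the free (`A = 0`) Neumann Laplacian `−Δ^N_Ω` of (1.3) in lattice units
(`(lapN Ω φ)(x) = Σ_μ([⟨x,x+e_μ⟩ ∈ Ω*](φ(x) − φ(x+e_μ)) + [⟨x−e_μ,x⟩ ∈ Ω*](φ(x) − φ(x−e_μ)))`, exactly the left side of p27's
`BIJ88NeumannPropagatorSmallFieldSupDecay.kato_region`); the massive operators `M_s = s·lapN Ω + 1`, `s ≥ 0` (at `s = L^{2k}`: [6]'s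
`n²(−Δ^N_Ω) + m²` of (1.6)/(2.44)–(2.45) at `A = 0`, `a = 0` with one unit of mass on the block scale, b04's `boxOpR n 0 1 M` when `Ω` is a
box); the reflecting lazy walk
`P = 1 − (8D)⁻¹lapN Ω` (`D = P.d`; a symmetric stochastic matrix, sites outside `Ω` hold); for a weight `ψ` the conjugated walk
`(P_ψg)(z) = Σ_y e^{ψ(z)−ψ(y)}P(z,y)g(y)` (written out, no definition); the Neumann form `E_Ω(g) = Σ_{b∈Ω*}(g(b₊) − g(b₋))²`.

THE MECHANISM OF THE FOUR FILES (DIVERGENCE OF METHOD from the printed random-walk expansion of [6], disclosed as in every file of the lineage).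
File 4 repeats p27 gen 34's cube assembly on the region (Kato's inequality `kato_region` → comparison with `M_{L^{2k}}⁻¹` (this file, §2) →
Cauchy–Schwarz with the weight `e^{t|x−·|_∞/L^k}` → p34's weighted `ℓ²` (Agmon) bound on the region `agmon_weighted_region`), whose one missing
input for a GENERAL block union is the free tilted row bound `Σ_y(e^{t|x−y|_∞/L^k}M⁻¹(x,y))² ≤ C₀L^{−kD}` (file 3).  File 3 gets it WITHOUT
multiscale pieces, from `M⁻¹ = cΣ_m q^mP^m` (`c = 1/(8DL^{2k}+1)`, `q = 1 − c`) and a discrete NASH–DAVIES iteration for the conjugated walk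
`P_ψ`: (§3 here) the weighted `ℓ²` step `‖P_ψg‖₂² ≤ (1+τ²)‖g‖₂² − E_Ω(g)/(8D)` for weights with `|ψ(b₊) − ψ(b₋)| ≤ τ ≤ 1` on `Ω*` (the
first-order terms cancel in `P_ψᵀP_ψ`; `|e^x − 1 − x| ≤ x²`, `|e^x − 1| ≤ 2|x|`) and the weighted `ℓ¹` step `Σ_z(P_ψg)(z) = Σ_y g(y)(1 +
(8D)⁻¹Σ_μ(e^{ψ(y+e_μ)−ψ(y)} + e^{ψ(y−e_μ)−ψ(y)} − 2))` for `g` supported in `Ω` and `ψ` FLAT ACROSS THE BONDS LEAVING `Ω` (so that the drift is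
second order also at the Neumann boundary sites — the point that makes arbitrary block unions tractable); file 2 the scale-`L^j` Nash inequality
on block unions; file 3 the weight profile, the descent lemma and the series.

WHAT IS PROVED (0 `sorry`; standard axioms; two definitions `bvec`/`lapN`, no `Prop`-valued fact).
* §1 `bvec`, `lapN` (defs); `bvec_apply`, `bvec_dotProduct`, `dotProduct_bvec`, **`lapN_mulVec_eq_sum`**
  (`lapN φ = Σ_{b∈Ω*}(φ(b₊)−φ(b₋))v_b`), **`dotProduct_lapN_mulVec`** (the form
  `ψ·lapN φ = Σ_{b∈Ω*}(ψ(b₊)−ψ(b₋))(φ(b₊)−φ(b₋))`), **`lapN_mulVec_apply`** (the pointwise formula of `kato_region`'s shape), `lapN_mulVec_const`,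
  `lapN_transpose`, `lapN_mulVec_eq_zero_of_not_mem` (rows outside `Ω` vanish), `lapN_mulVec_eq_zero_of_support` (columns outside `Ω`).
* §2 `massOp_mulVec_apply`; **`nonneg_of_massOp_mulVec_nonneg`** (minimum principle for `M_s = s·lapN + 1`, `s ≥ 0`), **`isUnit_massOp`**,
  `massOp_mul_inv`, `inv_mul_massOp`, `inv_massOp_mulVec_nonneg`, **`le_inv_massOp_mulVec`** (comparison), `inv_massOp_apply_nonneg`,
  **`sum_inv_massOp_apply`** (row sums `1`), `massOp_transpose`, `inv_massOp_transpose`, `inv_massOp_apply_le_one`.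
* §3 `lapN_apply`, `bvec_trichotomy`, `bvec_pow_facts`, `sum_bvec_mul`, `sum_bvec_sq_mul`, **`sum_starB_bvec_mul`** (bond sums at a site as
  sums over directions), `sum_bvec_sq_le` (at most `2D` bonds through a site), `sum_sq_bond_le` (`Σ_{b∈Ω*}(g(b₊)² + g(b₋)²) ≤ 2D‖g‖²`),
  `walk_apply`, **`walk_apply_nonneg`**, `walk_transpose`, `walk_apply_comm`, **`sum_walk_apply`** / `sum_walk_apply'` (row and column sums
  `1`), `walk_apply_of_not_mem` (sites outside `Ω` hold), **`cwalk_apply`** (the conjugated walk through the bonds), `cwalk_nonneg`,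
  `cwalk_eq_zero_of_not_mem`, `walk_mulVec_eq_zero_of_not_mem` (support in `Ω` is preserved), **`davies_step`** (the weighted `ℓ²` step),
  **`ell1_step_eq`** / **`ell1_step_le`** (the weighted `ℓ¹` step under flatness on the bonds leaving `Ω`).

HONEST SCOPE.  (i) Pure lattice analysis on the fine torus of `Setup` (`Site P 0`, `P.d` directions, `sitesPerDir 0 = 2L^{m+K} ≥ 2` sites
per direction): no gauge field, no propagator of the model appears; the transfer to p31's `gBox` is file 4's.  (ii) `Ω` is an arbitrary finite set
of sites in §1–§3 (the block structure enters only in files 2–3).  (iii) Constants explicit (`8D`, `1 + τ²`).  Nothing here is summit progress.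
Unit `lit-balaban-p34` (literature-prover-lit-balaban-p34-g18-0), HOME `run/shared/lean/pub/lit-balaban/`, 2026-08-23.  v1.1 DOC-ONLY
(same seat, referee ref-5 finding D-g67-2): [6]'s display labels corrected — the Neumann Laplacian is (1.3) and the fundamental Green's
function is (1.6) on p. 572 ((1.7) is the regularity condition on `A`); v1.0's mis-transcribed «(1.7)» sentence replaced by the held print's
(1.3)/(1.6) text; the 18 `kernel` tags «(1.7) p.572» re-pointed to (1.3) p.572; every declaration byte-identical to v1.0 (p352817).
-/

open scoped BigOperators
open Finset Matrix

namespace Literature.MathematicalPhysics.QuantumFieldTheory.BalabanImbrieJaffe1984to88.BIJ88FreeNeumannLaplacianRegion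

open Literature.MathematicalPhysics.QuantumFieldTheory.Balaban1983to89
open BIJ88Sect3Statements (starB mem_starB)
open BIJ85BlockAveragingIneq (sum_bond_eq)
open LatticeFieldCalculus (shiftEquiv)

noncomputable section

variable {P : Params}


/-! ## §1 The free Neumann Laplacian `−Δ^N_Ω = Σ_{b∈Ω*} v_bv_bᵀ` of a region, as a real matrix on the fine torus -/

/-- The bond vector `v_b = δ_{b₊} − δ_{b₋}` of the free lattice gradient, `v_b·φ = φ(b₊) − φ(b₋) = η(D^η_0φ)(b)` ([6] (1.3) at `A = 0`).
[cite: Balaban1983RegularityDecay, (1.3) p.572] -/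
def bvec (b : PBond P 0) : Balaban1983to89.Site P 0 → ℝ :=
  fun y => (if y = b.tgt then 1 else 0) - (if y = b.src then 1 else 0)

/-- **THE FREE NEUMANN LAPLACIAN `−Δ^N_Ω` OF A REGION `Ω ⊂ T^{(0)}`** in lattice units: the sum over the bonds `b ∈ Ω*` (both endpoints in `Ω`)
of the rank-one forms `v_bv_bᵀ`, `v_b = δ_{b₊} − δ_{b₋}` — [6] (1.3) *"the covariant Laplace operator −Δ^{η,N}_{A,Ω} on a domain Ω with Neumann
boundary conditions on ∂Ω … the summation is over the set of all bonds b = ⟨b₋, b₊⟩ with end-points b₋, b₊ in Ω"* at `A = 0`, `η = 1`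
(quadratic form `Σ_{b∈Ω*}(φ(b₊) − φ(b₋))²`); rows and columns outside `Ω` vanish. [cite: Balaban1983RegularityDecay, (1.3) p.572] -/
def lapN (Ω : Finset (Balaban1983to89.Site P 0)) : Matrix (Balaban1983to89.Site P 0) (Balaban1983to89.Site P 0) ℝ :=
  ∑ b ∈ starB Ω, vecMulVec (bvec b) (bvec b)

/-- kernel: the entry `v_b(y) = [y = b₊] − [y = b₋]`. [cite: Balaban1983RegularityDecay, (1.3) p.572] -/
theorem bvec_apply (b : PBond P 0) (y : Balaban1983to89.Site P 0) :
    bvec b y = (if y = b.tgt then 1 else 0) - (if y = b.src then 1 else 0) := rfl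

/-- kernel: `v_b·φ = φ(b₊) − φ(b₋)`. [cite: Balaban1983RegularityDecay, (1.3) p.572] -/
theorem bvec_dotProduct (b : PBond P 0) (φ : Balaban1983to89.Site P 0 → ℝ) : bvec b ⬝ᵥ φ = φ b.tgt - φ b.src := by
  simp only [dotProduct, bvec_apply, sub_mul, Finset.sum_sub_distrib, ite_mul, one_mul, zero_mul, Finset.sum_ite_eq', mem_univ, if_true]

/-- kernel: `φ·v_b = φ(b₊) − φ(b₋)`. [cite: Balaban1983RegularityDecay, (1.3) p.572] -/
theorem dotProduct_bvec (b : PBond P 0) (φ : Balaban1983to89.Site P 0 → ℝ) : φ ⬝ᵥ bvec b = φ b.tgt - φ b.src := by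
  rw [dotProduct_comm, bvec_dotProduct]

/-- **`lapN φ = Σ_{b∈Ω*}(φ(b₊) − φ(b₋))·v_b`** pointwise. [cite: Balaban1983RegularityDecay, (1.3) p.572] -/
theorem lapN_mulVec_eq_sum (Ω : Finset (Balaban1983to89.Site P 0)) (φ : Balaban1983to89.Site P 0 → ℝ) (y : Balaban1983to89.Site P 0) :
    (lapN Ω *ᵥ φ) y = ∑ b ∈ starB Ω, (φ b.tgt - φ b.src) * bvec b y := by
  simp only [lapN, mulVec, dotProduct, Matrix.sum_apply, vecMulVec_apply, Finset.sum_mul]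
  rw [Finset.sum_comm]
  refine sum_congr rfl fun b _ => ?_
  have h := bvec_dotProduct b φ
  simp only [dotProduct] at h
  calc ∑ x, bvec b y * bvec b x * φ x = bvec b y * ∑ x, bvec b x * φ x := by
        rw [Finset.mul_sum]; exact sum_congr rfl fun x _ => by ring
    _ = (φ b.tgt - φ b.src) * bvec b y := by rw [h]; ring

/-- **THE NEUMANN FORM OF THE REGION**: `ψ·(lapN Ω φ) = Σ_{b∈Ω*}(ψ(b₊) − ψ(b₋))(φ(b₊) − φ(b₋))` ([6] (1.3): the quadratic form of `−Δ^N_Ω`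
is the bond sum over `Ω*`). [cite: Balaban1983RegularityDecay, (1.3) p.572] -/
theorem dotProduct_lapN_mulVec (Ω : Finset (Balaban1983to89.Site P 0)) (ψ φ : Balaban1983to89.Site P 0 → ℝ) :
    ψ ⬝ᵥ (lapN Ω *ᵥ φ) = ∑ b ∈ starB Ω, (ψ b.tgt - ψ b.src) * (φ b.tgt - φ b.src) := by
  have e : lapN Ω *ᵥ φ = fun y => ∑ b ∈ starB Ω, (φ b.tgt - φ b.src) * bvec b y := funext fun y => lapN_mulVec_eq_sum Ω φ y
  rw [e]
  simp only [dotProduct, Finset.mul_sum]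
  rw [Finset.sum_comm]
  refine sum_congr rfl fun b _ => ?_
  have h := dotProduct_bvec b ψ
  simp only [dotProduct] at h
  calc ∑ x, ψ x * ((φ b.tgt - φ b.src) * bvec b x) = (φ b.tgt - φ b.src) * ∑ x, ψ x * bvec b x := by
        rw [Finset.mul_sum]; exact sum_congr rfl fun x _ => by ring
    _ = (ψ b.tgt - ψ b.src) * (φ b.tgt - φ b.src) := by rw [h]; ring

/-- kernel: the quadratic form is the Neumann energy `E_Ω(φ) = Σ_{b∈Ω*}(φ(b₊) − φ(b₋))² ≥ 0`. [cite: Balaban1983RegularityDecay, (1.3) p.572] -/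
theorem dotProduct_lapN_mulVec_self (Ω : Finset (Balaban1983to89.Site P 0)) (φ : Balaban1983to89.Site P 0 → ℝ) :
    φ ⬝ᵥ (lapN Ω *ᵥ φ) = ∑ b ∈ starB Ω, (φ b.tgt - φ b.src) ^ 2 := by
  rw [dotProduct_lapN_mulVec]; exact sum_congr rfl fun b _ => by ring

/-- kernel: a bond is never a loop on the fine torus (`2L^{m+K} ≥ 2` sites per direction): `x + e_μ ≠ x`. [folklore] -/
private theorem shift_ne_self (x : Balaban1983to89.Site P 0) (μ : Fin P.d) : x.shift μ ≠ x := by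
  intro h
  have h1 : (x.shift μ) μ = x μ := by rw [h]
  simp only [Balaban1983to89.Site.shift, Function.update_self] at h1
  have h2 : (1 : ZMod (P.sitesPerDir 0)) = 0 := by
    have h' := congrArg (fun a => a - x μ) h1
    simp only [add_sub_cancel_left, sub_self] at h'
    exact h' 
  have h3 := P.one_lt_sitesPerDir 0
  have : Fact (1 < P.sitesPerDir 0) := ⟨h3⟩
  exact one_ne_zero h2

/-- kernel: `b₊ ≠ b₋`. [folklore] -/
private theorem tgt_ne_src (b : PBond P 0) : b.tgt ≠ b.src := shift_ne_self b.src b.dir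

/-- kernel: `z + e_μ = y ↔ z = y − e_μ`. [folklore] -/
private theorem shift_eq_iff (z y : Balaban1983to89.Site P 0) (μ : Fin P.d) : z.shift μ = y ↔ z = y.unshift μ := by
  constructor
  · intro h; rw [← h]; exact ((shiftEquiv μ).left_inv z).symm
  · intro h; rw [h]; exact (shiftEquiv μ).right_inv y

/-- **`(lapN Ω φ)(x) = Σ_μ([⟨x,x+e_μ⟩ ∈ Ω*](φ(x) − φ(x+e_μ)) + [⟨x−e_μ,x⟩ ∈ Ω*](φ(x) − φ(x−e_μ)))`** — the pointwise formula, in the shape of the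
left side of p27's `kato_region` (with `c = 1`, `m = 0`). [cite: Balaban1983RegularityDecay, (1.3) p.572] -/
theorem lapN_mulVec_apply (Ω : Finset (Balaban1983to89.Site P 0)) (φ : Balaban1983to89.Site P 0 → ℝ) (x : Balaban1983to89.Site P 0) :
    (lapN Ω *ᵥ φ) x = ∑ μ : Fin P.d, ((if (⟨x, μ⟩ : PBond P 0) ∈ starB Ω then φ x - φ (x.shift μ) else 0) +
        (if (⟨x.unshift μ, μ⟩ : PBond P 0) ∈ starB Ω then φ x - φ (x.unshift μ) else 0)) := by
  classical
  rw [lapN_mulVec_eq_sum]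
  have hS : univ.filter (fun b : PBond P 0 => b ∈ starB Ω) = starB Ω := by ext b; simp
  -- the restricted bond sum as an indicator sum over all bonds, indicator on the coefficient
  have e1 : ∑ b ∈ starB Ω, (φ b.tgt - φ b.src) * bvec b x =
      ∑ b : PBond P 0, (if b ∈ starB Ω then φ b.tgt - φ b.src else 0) *
        ((if x = b.tgt then (1 : ℝ) else 0) - (if x = b.src then 1 else 0)) := by
    rw [← hS, sum_filter]
    refine sum_congr rfl fun b _ => ?_
    rw [bvec_apply]
    by_cases hb : b ∈ starB Ω
    · simp [hb]
    · simp [hb]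
  rw [e1, sum_bond_eq, Finset.sum_comm]
  refine sum_congr rfl fun μ _ => ?_
  -- for a fixed direction: the two delta terms
  have htgt : ∀ z : Balaban1983to89.Site P 0, (⟨z, μ⟩ : PBond P 0).tgt = z.shift μ := fun z => rfl
  simp only [htgt, mul_sub, Finset.sum_sub_distrib]
  -- the `δ_{z+e_μ}(x)` term: only `z = x − e_μ` contributes
  have hA : ∑ z : Balaban1983to89.Site P 0, (if (⟨z, μ⟩ : PBond P 0) ∈ starB Ω then φ (z.shift μ) - φ z else 0) *
      (if x = z.shift μ then (1 : ℝ) else 0) =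
      (if (⟨x.unshift μ, μ⟩ : PBond P 0) ∈ starB Ω then φ x - φ (x.unshift μ) else 0) := by
    rw [Finset.sum_eq_single (x.unshift μ)]
    · have e : (x.unshift μ).shift μ = x := (shiftEquiv μ).right_inv x
      rw [e, if_pos rfl, mul_one]
    · intro z _ hz
      have hne : x ≠ z.shift μ := fun h => hz ((shift_eq_iff z x μ).1 h.symm)
      rw [if_neg hne, mul_zero]
    · exact fun h => absurd (mem_univ _) h
  -- the `δ_z(x)` term: only `z = x` contributes
  have hB : ∑ z : Balaban1983to89.Site P 0, (if (⟨z, μ⟩ : PBond P 0) ∈ starB Ω then φ (z.shift μ) - φ z else 0) *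
      (if x = z then (1 : ℝ) else 0) =
      (if (⟨x, μ⟩ : PBond P 0) ∈ starB Ω then φ (x.shift μ) - φ x else 0) := by
    rw [Finset.sum_eq_single x]
    · rw [if_pos rfl, mul_one]
    · intro z _ hz
      rw [if_neg (Ne.symm hz), mul_zero]
    · exact fun h => absurd (mem_univ _) h
  rw [hA, hB]
  by_cases h1 : (⟨x, μ⟩ : PBond P 0) ∈ starB Ω <;> by_cases h2 : (⟨x.unshift μ, μ⟩ : PBond P 0) ∈ starB Ω <;>
    simp only [h1, h2, if_true, if_false] <;> ring

/-- kernel: `lapN` kills constants. [cite: Balaban1983RegularityDecay, (1.3) p.572] -/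
theorem lapN_mulVec_const (Ω : Finset (Balaban1983to89.Site P 0)) (c : ℝ) (x : Balaban1983to89.Site P 0) :
    (lapN Ω *ᵥ fun _ => c) x = 0 := by
  rw [lapN_mulVec_eq_sum]; simp

/-- kernel: `lapN` is symmetric. [cite: Balaban1983RegularityDecay, (1.3) p.572] -/
theorem lapN_transpose (Ω : Finset (Balaban1983to89.Site P 0)) : (lapN Ω)ᵀ = lapN Ω := by
  rw [lapN, transpose_sum]
  exact sum_congr rfl fun b _ => by rw [transpose_vecMulVec]

/-- kernel: the rows of `lapN Ω` outside `Ω` vanish (no bond of `Ω*` touches a site outside `Ω`). [cite: Balaban1983RegularityDecay, (1.3) p.572] -/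
theorem lapN_mulVec_eq_zero_of_not_mem (Ω : Finset (Balaban1983to89.Site P 0)) (φ : Balaban1983to89.Site P 0 → ℝ)
    {x : Balaban1983to89.Site P 0} (hx : x ∉ Ω) : (lapN Ω *ᵥ φ) x = 0 := by
  rw [lapN_mulVec_apply]
  refine sum_eq_zero fun μ _ => ?_
  have h1 : (⟨x, μ⟩ : PBond P 0) ∉ starB Ω := fun h => hx ((mem_starB Ω _).1 h).1
  have h2 : (⟨x.unshift μ, μ⟩ : PBond P 0) ∉ starB Ω := by
    intro h
    have ht := ((mem_starB Ω _).1 h).2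
    have e : (⟨x.unshift μ, μ⟩ : PBond P 0).tgt = x := (shiftEquiv μ).right_inv x
    rw [e] at ht
    exact hx ht
  rw [if_neg h1, if_neg h2, add_zero]

/-- kernel: `lapN Ω φ` depends only on `φ|_Ω`: if `φ` vanishes on `Ω` then `lapN Ω φ = 0`. [cite: Balaban1983RegularityDecay, (1.3) p.572] -/
theorem lapN_mulVec_eq_zero_of_support (Ω : Finset (Balaban1983to89.Site P 0)) {φ : Balaban1983to89.Site P 0 → ℝ}
    (hφ : ∀ y ∈ Ω, φ y = 0) (x : Balaban1983to89.Site P 0) : (lapN Ω *ᵥ φ) x = 0 := by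
  rw [lapN_mulVec_eq_sum]
  refine sum_eq_zero fun b hb => ?_
  rw [hφ _ ((mem_starB Ω b).1 hb).2, hφ _ ((mem_starB Ω b).1 hb).1, sub_zero, zero_mul]

/-! ## §2 The massive operators `M_s = s·(−Δ^N_Ω) + 1`: minimum principle, inverse, comparison, row sums -/

/-- kernel: `(M_sv)(x) = s·(lapN v)(x) + v(x)`. [cite: Balaban1983RegularityDecay, (2.44) p.584] -/
theorem massOp_mulVec_apply (s : ℝ) (Ω : Finset (Balaban1983to89.Site P 0)) (v : Balaban1983to89.Site P 0 → ℝ)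
    (x : Balaban1983to89.Site P 0) : ((s • lapN Ω + 1) *ᵥ v) x = s * (lapN Ω *ᵥ v) x + v x := by
  rw [add_mulVec, smul_mulVec, one_mulVec, Pi.add_apply, Pi.smul_apply, smul_eq_mul]

/-- **MINIMUM PRINCIPLE** for `M_s = s(−Δ^N_Ω) + 1`, `s ≥ 0`: `M_sv ≥ 0` pointwise ⟹ `v ≥ 0` (at a minimum point of `v` every Neumann
difference `v(x₀) − v(x₀ ± e_μ)` that occurs is `≤ 0`, so `0 ≤ (M_sv)(x₀) ≤ v(x₀)`) — the M-matrix property behind the comparison step of the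
sup-norm route, as in p27's `BIJ85FreeResolventTorus.nonneg_of_H_mulVec_nonneg` / `BIJ88FreeNeumannResolventBox`.
[cite: Balaban1983RegularityDecay, (2.44) p.584] -/
theorem nonneg_of_massOp_mulVec_nonneg {s : ℝ} (hs : 0 ≤ s) (Ω : Finset (Balaban1983to89.Site P 0)) (v : Balaban1983to89.Site P 0 → ℝ)
    (h : ∀ x, 0 ≤ ((s • lapN Ω + 1) *ᵥ v) x) : ∀ x, 0 ≤ v x := by
  obtain ⟨x₀, -, hx₀⟩ := exists_min_image univ v univ_nonempty
  have hle : ((s • lapN Ω + 1) *ᵥ v) x₀ ≤ v x₀ := by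
    rw [massOp_mulVec_apply, lapN_mulVec_apply]
    have hsum : ∑ μ : Fin P.d, ((if (⟨x₀, μ⟩ : PBond P 0) ∈ starB Ω then v x₀ - v (x₀.shift μ) else 0) +
        (if (⟨x₀.unshift μ, μ⟩ : PBond P 0) ∈ starB Ω then v x₀ - v (x₀.unshift μ) else 0)) ≤ 0 := by
      refine sum_nonpos fun μ _ => add_nonpos ?_ ?_
      · split_ifs
        · exact sub_nonpos.2 (hx₀ _ (mem_univ _))
        · exact le_rfl
      · split_ifs
        · exact sub_nonpos.2 (hx₀ _ (mem_univ _))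
        · exact le_rfl
    nlinarith
  have h0 : 0 ≤ v x₀ := (h x₀).trans hle
  exact fun x => h0.trans (hx₀ x (mem_univ _))

/-- **`M_s = s(−Δ^N_Ω) + 1` IS INVERTIBLE** (`s ≥ 0`; injectivity from the minimum principle applied to `±v`).
[cite: Balaban1983RegularityDecay, (2.44) p.584] -/
theorem isUnit_massOp {s : ℝ} (hs : 0 ≤ s) (Ω : Finset (Balaban1983to89.Site P 0)) : IsUnit (s • lapN Ω + 1) := by
  rw [← Matrix.mulVec_injective_iff_isUnit]
  intro v v' hvv'
  have hz : (s • lapN Ω + 1) *ᵥ (v - v') = 0 := by rw [mulVec_sub, hvv', sub_self]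
  have h1 := nonneg_of_massOp_mulVec_nonneg hs Ω (v - v') fun x => by rw [hz]; rfl
  have h2 := nonneg_of_massOp_mulVec_nonneg hs Ω (v' - v) fun x => by
    rw [show v' - v = -(v - v') by abel, mulVec_neg, hz, neg_zero]; rfl
  funext x
  have a := h1 x; have b := h2 x
  simp only [Pi.sub_apply] at a b
  linarith

/-- kernel: `M_s·M_s⁻¹ = 1`. [cite: Balaban1983RegularityDecay, (2.44) p.584] -/
theorem massOp_mul_inv {s : ℝ} (hs : 0 ≤ s) (Ω : Finset (Balaban1983to89.Site P 0)) :
    (s • lapN Ω + 1) * (s • lapN Ω + 1)⁻¹ = 1 :=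
  mul_nonsing_inv _ ((isUnit_iff_isUnit_det _).mp (isUnit_massOp hs Ω))

/-- kernel: `M_s⁻¹·M_s = 1`. [cite: Balaban1983RegularityDecay, (2.44) p.584] -/
theorem inv_mul_massOp {s : ℝ} (hs : 0 ≤ s) (Ω : Finset (Balaban1983to89.Site P 0)) :
    (s • lapN Ω + 1)⁻¹ * (s • lapN Ω + 1) = 1 :=
  nonsing_inv_mul _ ((isUnit_iff_isUnit_det _).mp (isUnit_massOp hs Ω))

/-- **THE FREE NEUMANN RESOLVENT OF THE REGION IS POSITIVITY PRESERVING**: `g ≥ 0 ⟹ M_s⁻¹g ≥ 0`. [cite: Balaban1983RegularityDecay, (2.44) p.584] -/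
theorem inv_massOp_mulVec_nonneg {s : ℝ} (hs : 0 ≤ s) (Ω : Finset (Balaban1983to89.Site P 0)) {g : Balaban1983to89.Site P 0 → ℝ}
    (hg : ∀ x, 0 ≤ g x) (x : Balaban1983to89.Site P 0) : 0 ≤ ((s • lapN Ω + 1)⁻¹ *ᵥ g) x :=
  nonneg_of_massOp_mulVec_nonneg hs Ω _ (fun z => by rw [mulVec_mulVec, massOp_mul_inv hs, one_mulVec]; exact hg z) x

/-- **COMPARISON PRINCIPLE**: `M_sv ≤ g` pointwise ⟹ `v ≤ M_s⁻¹g` pointwise. [cite: Balaban1983RegularityDecay, (2.44) p.584] -/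
theorem le_inv_massOp_mulVec {s : ℝ} (hs : 0 ≤ s) (Ω : Finset (Balaban1983to89.Site P 0)) {v g : Balaban1983to89.Site P 0 → ℝ}
    (h : ∀ x, ((s • lapN Ω + 1) *ᵥ v) x ≤ g x) (x : Balaban1983to89.Site P 0) : v x ≤ ((s • lapN Ω + 1)⁻¹ *ᵥ g) x := by
  have key := nonneg_of_massOp_mulVec_nonneg hs Ω ((s • lapN Ω + 1)⁻¹ *ᵥ g - v) (fun z => by
    rw [mulVec_sub, mulVec_mulVec, massOp_mul_inv hs, one_mulVec, Pi.sub_apply]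
    exact sub_nonneg.2 (h z)) x
  rw [Pi.sub_apply] at key
  linarith

/-- kernel: the entries of `M_s⁻¹` are nonnegative. [cite: Balaban1983RegularityDecay, (2.44) p.584] -/
theorem inv_massOp_apply_nonneg {s : ℝ} (hs : 0 ≤ s) (Ω : Finset (Balaban1983to89.Site P 0)) (x z : Balaban1983to89.Site P 0) :
    0 ≤ (s • lapN Ω + 1)⁻¹ x z := by
  have h := inv_massOp_mulVec_nonneg hs Ω (g := Pi.single z 1) (fun y => by
    by_cases hy : y = z
    · subst hy; simp
    · simp [hy]) x
  rwa [mulVec_single, MulOpposite.op_one, one_smul] at h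

/-- kernel: `M_s` fixes the constants. [cite: Balaban1983RegularityDecay, (2.44) p.584] -/
theorem massOp_mulVec_const (s : ℝ) (Ω : Finset (Balaban1983to89.Site P 0)) (c : ℝ) :
    (s • lapN Ω + 1) *ᵥ (fun _ : Balaban1983to89.Site P 0 => c) = fun _ => c := by
  funext x; rw [massOp_mulVec_apply, lapN_mulVec_const, mul_zero, zero_add]

/-- kernel: `M_s⁻¹` fixes the constants. [cite: Balaban1983RegularityDecay, (2.44) p.584] -/
theorem inv_massOp_mulVec_const {s : ℝ} (hs : 0 ≤ s) (Ω : Finset (Balaban1983to89.Site P 0)) (c : ℝ) :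
    (s • lapN Ω + 1)⁻¹ *ᵥ (fun _ : Balaban1983to89.Site P 0 => c) = fun _ => c := by
  conv_lhs => rw [← massOp_mulVec_const s Ω c]
  rw [mulVec_mulVec, inv_mul_massOp hs, one_mulVec]

/-- **THE ROW SUMS OF THE FREE NEUMANN RESOLVENT ARE `1`**: `Σ_z M_s⁻¹(x,z) = 1` (one unit of mass; `−Δ^N_Ω` kills constants).
[cite: Balaban1983RegularityDecay, (2.44) p.584] -/
theorem sum_inv_massOp_apply {s : ℝ} (hs : 0 ≤ s) (Ω : Finset (Balaban1983to89.Site P 0)) (x : Balaban1983to89.Site P 0) :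
    ∑ z, (s • lapN Ω + 1)⁻¹ x z = 1 := by
  have h := congrFun (inv_massOp_mulVec_const hs Ω (1 : ℝ)) x
  simp only [mulVec, dotProduct, mul_one] at h
  exact h

/-- kernel: `M_s` is symmetric. [cite: Balaban1983RegularityDecay, (2.44) p.584] -/
theorem massOp_transpose (s : ℝ) (Ω : Finset (Balaban1983to89.Site P 0)) : (s • lapN Ω + 1)ᵀ = s • lapN Ω + 1 := by
  rw [transpose_add, transpose_smul, transpose_one, lapN_transpose]

/-- kernel: `M_s⁻¹` is symmetric. [cite: Balaban1983RegularityDecay, (2.44) p.584] -/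
theorem inv_massOp_transpose (s : ℝ) (Ω : Finset (Balaban1983to89.Site P 0)) : ((s • lapN Ω + 1)⁻¹)ᵀ = (s • lapN Ω + 1)⁻¹ := by
  rw [transpose_nonsing_inv, massOp_transpose]

/-- kernel: every entry of `M_s⁻¹` is at most `1` (nonnegative entries, row sum `1`). [cite: Balaban1983RegularityDecay, (2.44) p.584] -/
theorem inv_massOp_apply_le_one {s : ℝ} (hs : 0 ≤ s) (Ω : Finset (Balaban1983to89.Site P 0)) (x z : Balaban1983to89.Site P 0) :
    (s • lapN Ω + 1)⁻¹ x z ≤ 1 := by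
  rw [← sum_inv_massOp_apply hs Ω x]
  exact single_le_sum (f := fun z => (s • lapN Ω + 1)⁻¹ x z) (fun z _ => inv_massOp_apply_nonneg hs Ω x z) (mem_univ z)

/-- kernel: on a row outside `Ω`, `M_s` is the identity: `(M_sv)(x) = v(x)` for `x ∉ Ω`. [cite: Balaban1983RegularityDecay, (2.44) p.584] -/
theorem massOp_mulVec_apply_of_not_mem (s : ℝ) (Ω : Finset (Balaban1983to89.Site P 0)) (v : Balaban1983to89.Site P 0 → ℝ)
    {x : Balaban1983to89.Site P 0} (hx : x ∉ Ω) : ((s • lapN Ω + 1) *ᵥ v) x = v x := by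
  rw [massOp_mulVec_apply, lapN_mulVec_eq_zero_of_not_mem Ω v hx, mul_zero, zero_add]

/-! ## §3 The reflecting lazy walk `P = 1 − (8D)⁻¹(−Δ^N_Ω)`: stochasticity, the weighted `ℓ²` (Davies) step, the weighted `ℓ¹` step -/

section Walk

/-- kernel: the entries of `lapN`: `lapN Ω z y = Σ_{b∈Ω*} v_b(z)v_b(y)`. [cite: Balaban1983RegularityDecay, (1.3) p.572] -/
theorem lapN_apply (Ω : Finset (Balaban1983to89.Site P 0)) (z y : Balaban1983to89.Site P 0) :
    lapN Ω z y = ∑ b ∈ starB Ω, bvec b z * bvec b y := by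
  simp only [lapN, Matrix.sum_apply, vecMulVec_apply]

/-- kernel: the values of `v_b`: `0`, `1` (at `b₊`) or `−1` (at `b₋`). [cite: Balaban1983RegularityDecay, (1.3) p.572] -/
theorem bvec_trichotomy (b : PBond P 0) (z : Balaban1983to89.Site P 0) : bvec b z = 0 ∨ bvec b z = 1 ∨ bvec b z = -1 := by
  rw [bvec_apply]
  by_cases h1 : z = b.tgt
  · have h2 : z ≠ b.src := fun h => tgt_ne_src b (h1.symm.trans h)
    rw [if_pos h1, if_neg h2]; norm_num
  · by_cases h2 : z = b.src
    · rw [if_neg h1, if_pos h2]; norm_num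
    · rw [if_neg h1, if_neg h2]; norm_num

/-- kernel: `v_b(z)² ≤ 1`, `v_b(z)³ = v_b(z)`, `v_b(z)⁴ = v_b(z)²`. [cite: Balaban1983RegularityDecay, (1.3) p.572] -/
theorem bvec_pow_facts (b : PBond P 0) (z : Balaban1983to89.Site P 0) :
    bvec b z ^ 2 ≤ 1 ∧ bvec b z ^ 2 * bvec b z = bvec b z ∧ (bvec b z ^ 2) ^ 2 = bvec b z ^ 2 := by
  rcases bvec_trichotomy b z with h | h | h <;> rw [h] <;> norm_num

/-- kernel: `Σ_z v_b(z)F(z) = F(b₊) − F(b₋)`. [cite: Balaban1983RegularityDecay, (1.3) p.572] -/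
theorem sum_bvec_mul (b : PBond P 0) (F : Balaban1983to89.Site P 0 → ℝ) : ∑ z, bvec b z * F z = F b.tgt - F b.src :=
  bvec_dotProduct b F

/-- kernel: `Σ_z v_b(z)²F(z) = F(b₊) + F(b₋)`. [cite: Balaban1983RegularityDecay, (1.3) p.572] -/
theorem sum_bvec_sq_mul (b : PBond P 0) (F : Balaban1983to89.Site P 0 → ℝ) : ∑ z, bvec b z ^ 2 * F z = F b.tgt + F b.src := by
  have hts := tgt_ne_src b
  have e : ∀ z, bvec b z ^ 2 * F z = (if z = b.tgt then F z else 0) + (if z = b.src then F z else 0) := by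
    intro z
    rw [bvec_apply]
    by_cases h1 : z = b.tgt
    · have h2 : z ≠ b.src := fun h => hts (h1.symm.trans h)
      rw [if_pos h1, if_neg h2, if_pos h1, if_neg h2]; ring
    · by_cases h2 : z = b.src
      · rw [if_neg h1, if_pos h2, if_neg h1, if_pos h2]; ring
      · rw [if_neg h1, if_neg h2, if_neg h1, if_neg h2]; ring
  simp_rw [e]
  rw [sum_add_distrib, Finset.sum_ite_eq' univ b.tgt, Finset.sum_ite_eq' univ b.src, if_pos (mem_univ _), if_pos (mem_univ _)]

/-- kernel: **the bond sum at a site, as a sum over directions**: `Σ_{b∈Ω*} v_b(y)F(b) = Σ_μ([⟨y−e_μ,y⟩ ∈ Ω*]F⟨y−e_μ,y⟩ − [⟨y,y+e_μ⟩ ∈ Ω*]F⟨y,y+e_μ⟩)`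
(the bonds of `Ω*` through `y` end at `y` in direction `μ` or start at `y`). [cite: BalabanImbrieJaffe1988, (3.5) p.266] -/
theorem sum_starB_bvec_mul (Ω : Finset (Balaban1983to89.Site P 0)) (F : PBond P 0 → ℝ) (y : Balaban1983to89.Site P 0) :
    ∑ b ∈ starB Ω, bvec b y * F b = ∑ μ : Fin P.d, ((if (⟨y.unshift μ, μ⟩ : PBond P 0) ∈ starB Ω then F ⟨y.unshift μ, μ⟩ else 0) -
        (if (⟨y, μ⟩ : PBond P 0) ∈ starB Ω then F ⟨y, μ⟩ else 0)) := by
  classical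
  have hS : univ.filter (fun b : PBond P 0 => b ∈ starB Ω) = starB Ω := by ext b; simp
  have e1 : ∑ b ∈ starB Ω, bvec b y * F b =
      ∑ b : PBond P 0, ((if y = b.tgt then (1 : ℝ) else 0) - (if y = b.src then 1 else 0)) * (if b ∈ starB Ω then F b else 0) := by
    rw [← hS, sum_filter]
    refine sum_congr rfl fun b _ => ?_
    rw [bvec_apply]
    by_cases hb : b ∈ starB Ω
    · simp [hb]
    · simp [hb]
  rw [e1, sum_bond_eq, Finset.sum_comm]
  refine sum_congr rfl fun μ _ => ?_
  have htgt : ∀ z : Balaban1983to89.Site P 0, (⟨z, μ⟩ : PBond P 0).tgt = z.shift μ := fun z => rfl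
  simp only [htgt, sub_mul, Finset.sum_sub_distrib]
  have hA : ∑ z : Balaban1983to89.Site P 0, (if y = z.shift μ then (1 : ℝ) else 0) *
      (if (⟨z, μ⟩ : PBond P 0) ∈ starB Ω then F ⟨z, μ⟩ else 0) =
      (if (⟨y.unshift μ, μ⟩ : PBond P 0) ∈ starB Ω then F ⟨y.unshift μ, μ⟩ else 0) := by
    rw [Finset.sum_eq_single (y.unshift μ)]
    · have e : (y.unshift μ).shift μ = y := (shiftEquiv μ).right_inv y
      rw [e, if_pos rfl, one_mul]
    · intro z _ hz
      have hne : y ≠ z.shift μ := fun h => hz ((shift_eq_iff z y μ).1 h.symm)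
      rw [if_neg hne, zero_mul]
    · exact fun h => absurd (mem_univ _) h
  have hB : ∑ z : Balaban1983to89.Site P 0, (if y = z then (1 : ℝ) else 0) * (if (⟨z, μ⟩ : PBond P 0) ∈ starB Ω then F ⟨z, μ⟩ else 0) =
      (if (⟨y, μ⟩ : PBond P 0) ∈ starB Ω then F ⟨y, μ⟩ else 0) := by
    rw [Finset.sum_eq_single y]
    · rw [if_pos rfl, one_mul]
    · intro z _ hz
      rw [if_neg (Ne.symm hz), zero_mul]
    · exact fun h => absurd (mem_univ _) h
  rw [hA, hB]

/-- kernel: `Σ_b [y = b₋]·c = D·c` (the `D = P.d` bonds starting at `y`). [folklore] -/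
private theorem sum_ite_src (y : Balaban1983to89.Site P 0) (c : ℝ) : ∑ b : PBond P 0, (if y = b.src then c else 0) = P.d * c := by
  rw [sum_bond_eq]
  have e : ∀ z : Balaban1983to89.Site P 0, ∑ μ : Fin P.d, (if y = (⟨z, μ⟩ : PBond P 0).src then c else 0) = if y = z then P.d * c else 0 := by
    intro z
    by_cases h : y = z
    · subst h
      have : ∀ μ : Fin P.d, (if y = (⟨y, μ⟩ : PBond P 0).src then c else 0) = c := fun μ => if_pos rfl
      rw [sum_congr rfl fun μ _ => this μ, sum_const, card_univ, Fintype.card_fin, if_pos rfl]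
      simp
    · have : ∀ μ : Fin P.d, (if y = (⟨z, μ⟩ : PBond P 0).src then c else 0) = 0 := fun μ => if_neg h
      rw [sum_congr rfl fun μ _ => this μ, sum_const_zero, if_neg h]
  simp_rw [e]
  rw [Finset.sum_ite_eq univ y, if_pos (mem_univ _)]

/-- kernel: `Σ_b [y = b₊]·c = D·c` (the `D` bonds ending at `y`). [folklore] -/
private theorem sum_ite_tgt (y : Balaban1983to89.Site P 0) (c : ℝ) : ∑ b : PBond P 0, (if y = b.tgt then c else 0) = P.d * c := by
  rw [sum_bond_eq, Finset.sum_comm]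
  have e : ∀ μ : Fin P.d, ∑ z : Balaban1983to89.Site P 0, (if y = (⟨z, μ⟩ : PBond P 0).tgt then c else 0) = c := by
    intro μ
    rw [Finset.sum_eq_single (y.unshift μ)]
    · have e : (⟨y.unshift μ, μ⟩ : PBond P 0).tgt = y := (shiftEquiv μ).right_inv y
      rw [e, if_pos rfl]
    · intro z _ hz
      have hne : y ≠ (⟨z, μ⟩ : PBond P 0).tgt := fun h => hz ((shift_eq_iff z y μ).1 h.symm)
      rw [if_neg hne]
    · exact fun h => absurd (mem_univ _) h
  simp_rw [e]
  rw [sum_const, card_univ, Fintype.card_fin, nsmul_eq_mul]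

/-- kernel: **at most `2D` bonds of `Ω*` pass through a site**: `Σ_{b∈Ω*} v_b(y)² ≤ 2D`. [cite: BalabanImbrieJaffe1988, (3.5) p.266] -/
theorem sum_bvec_sq_le (Ω : Finset (Balaban1983to89.Site P 0)) (y : Balaban1983to89.Site P 0) :
    ∑ b ∈ starB Ω, bvec b y ^ 2 ≤ 2 * P.d := by
  have h1 : ∑ b ∈ starB Ω, bvec b y ^ 2 ≤ ∑ b : PBond P 0, bvec b y ^ 2 :=
    sum_le_sum_of_subset_of_nonneg (subset_univ _) fun b _ _ => sq_nonneg _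
  have h2 : ∀ b : PBond P 0, bvec b y ^ 2 ≤ (if y = b.tgt then (1 : ℝ) else 0) + (if y = b.src then 1 else 0) := by
    intro b
    rw [bvec_apply]
    have hts := tgt_ne_src b
    by_cases ht : y = b.tgt
    · have hs : y ≠ b.src := fun h => hts (ht.symm.trans h)
      rw [if_pos ht, if_neg hs]; norm_num
    · by_cases hs : y = b.src
      · rw [if_neg ht, if_pos hs]; norm_num
      · rw [if_neg ht, if_neg hs]; norm_num
  have h3 : ∑ b : PBond P 0, bvec b y ^ 2 ≤ ∑ b : PBond P 0, ((if y = b.tgt then (1 : ℝ) else 0) + (if y = b.src then 1 else 0)) :=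
    sum_le_sum fun b _ => h2 b
  rw [sum_add_distrib, sum_ite_tgt, sum_ite_src] at h3
  linarith

/-- kernel: `Σ_{b∈Ω*}(g(b₊)² + g(b₋)²) ≤ 2D·Σ_y g(y)²` (every site lies on at most `2D` bonds). [cite: BalabanImbrieJaffe1988, (3.5) p.266] -/
theorem sum_sq_bond_le (Ω : Finset (Balaban1983to89.Site P 0)) (g : Balaban1983to89.Site P 0 → ℝ) :
    ∑ b ∈ starB Ω, (g b.tgt ^ 2 + g b.src ^ 2) ≤ 2 * P.d * ∑ y, g y ^ 2 := by
  have h1 : ∑ b ∈ starB Ω, (g b.tgt ^ 2 + g b.src ^ 2) ≤ ∑ b : PBond P 0, g b.tgt ^ 2 + ∑ b : PBond P 0, g b.src ^ 2 := by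
    rw [← sum_add_distrib]
    exact sum_le_sum_of_subset_of_nonneg (subset_univ _) fun b _ _ => add_nonneg (sq_nonneg _) (sq_nonneg _)
  have hsrc : ∑ b : PBond P 0, g b.src ^ 2 = P.d * ∑ y, g y ^ 2 := by
    rw [sum_bond_eq]
    have e : ∀ z : Balaban1983to89.Site P 0, ∑ μ : Fin P.d, g (⟨z, μ⟩ : PBond P 0).src ^ 2 = P.d * g z ^ 2 := by
      intro z
      show ∑ μ : Fin P.d, g z ^ 2 = _
      rw [sum_const, card_univ, Fintype.card_fin, nsmul_eq_mul]
    simp_rw [e]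
    rw [mul_sum]
  have htgt : ∑ b : PBond P 0, g b.tgt ^ 2 = P.d * ∑ y, g y ^ 2 := by
    rw [sum_bond_eq, Finset.sum_comm]
    have e : ∀ μ : Fin P.d, ∑ z : Balaban1983to89.Site P 0, g (⟨z, μ⟩ : PBond P 0).tgt ^ 2 = ∑ y, g y ^ 2 := by
      intro μ
      show ∑ z : Balaban1983to89.Site P 0, g (z.shift μ) ^ 2 = ∑ y, g y ^ 2
      exact Fintype.sum_equiv (shiftEquiv μ) _ _ fun _ => rfl
    simp_rw [e]
    rw [sum_const, card_univ, Fintype.card_fin, nsmul_eq_mul]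
  rw [hsrc, htgt] at h1
  linarith

/-- **THE ENTRIES OF THE WALK**: `P(z,y) = [z = y] − (8D)⁻¹Σ_{b∈Ω*}v_b(z)v_b(y)`. [cite: Balaban1983RegularityDecay, (1.3) p.572] -/
theorem walk_apply (Ω : Finset (Balaban1983to89.Site P 0)) (z y : Balaban1983to89.Site P 0) :
    ((1 : Matrix (Balaban1983to89.Site P 0) (Balaban1983to89.Site P 0) ℝ) - (8 * (P.d : ℝ))⁻¹ • lapN Ω) z y =
      (if z = y then 1 else 0) - (8 * (P.d : ℝ))⁻¹ * ∑ b ∈ starB Ω, bvec b z * bvec b y := by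
  rw [Matrix.sub_apply, Matrix.smul_apply, Matrix.one_apply, lapN_apply, smul_eq_mul]

/-- **THE WALK HAS NONNEGATIVE ENTRIES** (`P(z,z) ≥ 1 − 2D/(8D) = 3/4`; off the diagonal `v_b(z)v_b(y) ≤ 0`).
[cite: Balaban1983RegularityDecay, (1.3) p.572] -/
theorem walk_apply_nonneg (Ω : Finset (Balaban1983to89.Site P 0)) (z y : Balaban1983to89.Site P 0) :
    0 ≤ ((1 : Matrix (Balaban1983to89.Site P 0) (Balaban1983to89.Site P 0) ℝ) - (8 * (P.d : ℝ))⁻¹ • lapN Ω) z y := by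
  have hD : (1 : ℝ) ≤ P.d := by exact_mod_cast P.hd
  have hθ : 0 ≤ (8 * (P.d : ℝ))⁻¹ := by positivity
  rw [walk_apply]
  by_cases hzy : z = y
  · subst hzy
    rw [if_pos rfl]
    have h1 : ∑ b ∈ starB Ω, bvec b z * bvec b z = ∑ b ∈ starB Ω, bvec b z ^ 2 := sum_congr rfl fun b _ => by ring
    rw [h1]
    have h2 := sum_bvec_sq_le Ω z
    have h3 : (8 * (P.d : ℝ))⁻¹ * ∑ b ∈ starB Ω, bvec b z ^ 2 ≤ (8 * (P.d : ℝ))⁻¹ * (2 * P.d) := mul_le_mul_of_nonneg_left h2 hθ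
    have h4 : (8 * (P.d : ℝ))⁻¹ * (2 * P.d) = 1 / 4 := by field_simp; ring
    linarith
  · rw [if_neg hzy, zero_sub]
    have hle : ∑ b ∈ starB Ω, bvec b z * bvec b y ≤ 0 := by
      refine sum_nonpos fun b _ => ?_
      rw [bvec_apply, bvec_apply]
      have hts := tgt_ne_src b
      by_cases h1 : z = b.tgt
      · have h2 : z ≠ b.src := fun h => hts (h1.symm.trans h)
        have h3 : y ≠ b.tgt := fun h => hzy (h1.trans h.symm)
        rw [if_pos h1, if_neg h2, if_neg h3]
        split_ifs <;> norm_num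
      · by_cases h2 : z = b.src
        · have h3 : y ≠ b.src := fun h => hzy (h2.trans h.symm)
          rw [if_neg h1, if_pos h2, if_neg h3]
          split_ifs <;> norm_num
        · rw [if_neg h1, if_neg h2]
          norm_num
    nlinarith

/-- kernel: the walk is symmetric. [cite: Balaban1983RegularityDecay, (1.3) p.572] -/
theorem walk_transpose (Ω : Finset (Balaban1983to89.Site P 0)) :
    ((1 : Matrix (Balaban1983to89.Site P 0) (Balaban1983to89.Site P 0) ℝ) - (8 * (P.d : ℝ))⁻¹ • lapN Ω)ᵀ =
      (1 : Matrix (Balaban1983to89.Site P 0) (Balaban1983to89.Site P 0) ℝ) - (8 * (P.d : ℝ))⁻¹ • lapN Ω := by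
  rw [transpose_sub, transpose_one, transpose_smul, lapN_transpose]

/-- kernel: `P(z,y) = P(y,z)`. [cite: Balaban1983RegularityDecay, (1.3) p.572] -/
theorem walk_apply_comm (Ω : Finset (Balaban1983to89.Site P 0)) (z y : Balaban1983to89.Site P 0) :
    ((1 : Matrix (Balaban1983to89.Site P 0) (Balaban1983to89.Site P 0) ℝ) - (8 * (P.d : ℝ))⁻¹ • lapN Ω) z y =
      ((1 : Matrix (Balaban1983to89.Site P 0) (Balaban1983to89.Site P 0) ℝ) - (8 * (P.d : ℝ))⁻¹ • lapN Ω) y z := by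
  rw [walk_apply, walk_apply]
  congr 1
  · by_cases h : z = y
    · rw [h]
    · rw [if_neg h, if_neg (Ne.symm h)]
  · congr 1; exact sum_congr rfl fun b _ => mul_comm _ _

/-- **THE WALK IS STOCHASTIC**: `Σ_y P(z,y) = 1` (`−Δ^N_Ω` kills constants; sites outside `Ω` hold).
[cite: Balaban1983RegularityDecay, (1.3) p.572] -/
theorem sum_walk_apply (Ω : Finset (Balaban1983to89.Site P 0)) (z : Balaban1983to89.Site P 0) :
    ∑ y, ((1 : Matrix (Balaban1983to89.Site P 0) (Balaban1983to89.Site P 0) ℝ) - (8 * (P.d : ℝ))⁻¹ • lapN Ω) z y = 1 := by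
  simp_rw [walk_apply]
  rw [Finset.sum_sub_distrib, Finset.sum_ite_eq univ z, if_pos (mem_univ _), ← mul_sum, Finset.sum_comm]
  have h0 : ∑ b ∈ starB Ω, ∑ y, bvec b z * bvec b y = 0 := by
    refine sum_eq_zero fun b _ => ?_
    have h := sum_bvec_mul b (fun _ => (1 : ℝ))
    simp only [mul_one, sub_self] at h
    rw [← mul_sum, h, mul_zero]
  rw [h0, mul_zero, sub_zero]

/-- kernel: the column sums are `1` as well. [cite: Balaban1983RegularityDecay, (1.3) p.572] -/
theorem sum_walk_apply' (Ω : Finset (Balaban1983to89.Site P 0)) (y : Balaban1983to89.Site P 0) :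
    ∑ z, ((1 : Matrix (Balaban1983to89.Site P 0) (Balaban1983to89.Site P 0) ℝ) - (8 * (P.d : ℝ))⁻¹ • lapN Ω) z y = 1 := by
  simp_rw [walk_apply_comm Ω _ y]; exact sum_walk_apply Ω y

/-- kernel: outside `Ω` the walk holds: `P(z,y) = [z = y]` for `z ∉ Ω`. [cite: Balaban1983RegularityDecay, (1.3) p.572] -/
theorem walk_apply_of_not_mem (Ω : Finset (Balaban1983to89.Site P 0)) {z : Balaban1983to89.Site P 0} (hz : z ∉ Ω) (y : Balaban1983to89.Site P 0) :
    ((1 : Matrix (Balaban1983to89.Site P 0) (Balaban1983to89.Site P 0) ℝ) - (8 * (P.d : ℝ))⁻¹ • lapN Ω) z y = if z = y then 1 else 0 := by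
  rw [walk_apply]
  have h0 : ∑ b ∈ starB Ω, bvec b z * bvec b y = 0 := by
    refine sum_eq_zero fun b hb => ?_
    have h1 : z ≠ b.tgt := fun h => hz (h ▸ ((mem_starB Ω b).1 hb).2)
    have h2 : z ≠ b.src := fun h => hz (h ▸ ((mem_starB Ω b).1 hb).1)
    rw [bvec_apply, if_neg h1, if_neg h2, sub_zero, zero_mul]
  rw [h0, mul_zero, sub_zero]

/-- kernel: **the conjugated walk `(P_ψg)(z) = Σ_y e^{ψ(z)−ψ(y)}P(z,y)g(y)` written through the bonds**:
`(P_ψg)(z) = g(z) − (8D)⁻¹Σ_{b∈Ω*}v_b(z)(e^{ψ(z)−ψ(b₊)}g(b₊) − e^{ψ(z)−ψ(b₋)}g(b₋))`. [cite: Balaban1983RegularityDecay, (1.3) p.572] -/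
theorem cwalk_apply (Ω : Finset (Balaban1983to89.Site P 0)) (ψ g : Balaban1983to89.Site P 0 → ℝ) (z : Balaban1983to89.Site P 0) :
    ∑ y, Real.exp (ψ z - ψ y) * ((1 : Matrix (Balaban1983to89.Site P 0) (Balaban1983to89.Site P 0) ℝ) - (8 * (P.d : ℝ))⁻¹ • lapN Ω) z y * g y =
      g z - (8 * (P.d : ℝ))⁻¹ * ∑ b ∈ starB Ω, bvec b z * (Real.exp (ψ z - ψ b.tgt) * g b.tgt - Real.exp (ψ z - ψ b.src) * g b.src) := by
  have e1 : ∀ y, Real.exp (ψ z - ψ y) *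
      ((1 : Matrix (Balaban1983to89.Site P 0) (Balaban1983to89.Site P 0) ℝ) - (8 * (P.d : ℝ))⁻¹ • lapN Ω) z y * g y =
      (if z = y then Real.exp (ψ z - ψ y) * g y else 0) -
        (8 * (P.d : ℝ))⁻¹ * ∑ b ∈ starB Ω, bvec b z * (bvec b y * (Real.exp (ψ z - ψ y) * g y)) := by
    intro y
    rw [walk_apply]
    have hs : ∑ b ∈ starB Ω, bvec b z * (bvec b y * (Real.exp (ψ z - ψ y) * g y)) =
        (∑ b ∈ starB Ω, bvec b z * bvec b y) * (Real.exp (ψ z - ψ y) * g y) := by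
      rw [Finset.sum_mul]; exact sum_congr rfl fun b _ => by ring
    rw [hs]
    split_ifs <;> ring
  simp_rw [e1]
  rw [Finset.sum_sub_distrib, Finset.sum_ite_eq univ z, if_pos (mem_univ _), sub_self, Real.exp_zero, one_mul, ← mul_sum,
    Finset.sum_comm]
  congr 2
  refine sum_congr rfl fun b _ => ?_
  rw [← mul_sum, sum_bvec_mul b (fun y => Real.exp (ψ z - ψ y) * g y)]

/-- kernel: the conjugated walk preserves nonnegativity. [cite: Balaban1983RegularityDecay, (1.3) p.572] -/
theorem cwalk_nonneg (Ω : Finset (Balaban1983to89.Site P 0)) (ψ : Balaban1983to89.Site P 0 → ℝ) {g : Balaban1983to89.Site P 0 → ℝ}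
    (hg : ∀ y, 0 ≤ g y) (z : Balaban1983to89.Site P 0) :
    0 ≤ ∑ y, Real.exp (ψ z - ψ y) * ((1 : Matrix (Balaban1983to89.Site P 0) (Balaban1983to89.Site P 0) ℝ) - (8 * (P.d : ℝ))⁻¹ • lapN Ω) z y * g y :=
  sum_nonneg fun y _ => mul_nonneg (mul_nonneg (Real.exp_pos _).le (walk_apply_nonneg Ω z y)) (hg y)

/-- kernel: the conjugated walk preserves the support condition `supp g ⊆ Ω`. [cite: Balaban1983RegularityDecay, (1.3) p.572] -/
theorem cwalk_eq_zero_of_not_mem (Ω : Finset (Balaban1983to89.Site P 0)) (ψ : Balaban1983to89.Site P 0 → ℝ) {g : Balaban1983to89.Site P 0 → ℝ}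
    (hg : ∀ y, y ∉ Ω → g y = 0) {z : Balaban1983to89.Site P 0} (hz : z ∉ Ω) :
    ∑ y, Real.exp (ψ z - ψ y) *
        ((1 : Matrix (Balaban1983to89.Site P 0) (Balaban1983to89.Site P 0) ℝ) - (8 * (P.d : ℝ))⁻¹ • lapN Ω) z y * g y = 0 := by
  simp_rw [walk_apply_of_not_mem Ω hz]
  have e : ∀ y, Real.exp (ψ z - ψ y) * (if z = y then (1 : ℝ) else 0) * g y = if z = y then Real.exp (ψ z - ψ y) * g y else 0 := by
    intro y; split_ifs <;> ring
  simp_rw [e]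
  rw [Finset.sum_ite_eq univ z, if_pos (mem_univ _), hg z hz, mul_zero]

/-- kernel: the plain walk preserves the support condition `supp g ⊆ Ω`. [cite: Balaban1983RegularityDecay, (1.3) p.572] -/
theorem walk_mulVec_eq_zero_of_not_mem (Ω : Finset (Balaban1983to89.Site P 0)) {g : Balaban1983to89.Site P 0 → ℝ}
    (hg : ∀ y, y ∉ Ω → g y = 0) {z : Balaban1983to89.Site P 0} (hz : z ∉ Ω) :
    (((1 : Matrix (Balaban1983to89.Site P 0) (Balaban1983to89.Site P 0) ℝ) - (8 * (P.d : ℝ))⁻¹ • lapN Ω) *ᵥ g) z = 0 := by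
  have h := cwalk_eq_zero_of_not_mem Ω (fun _ => (0 : ℝ)) hg hz
  simp only [sub_self, Real.exp_zero, one_mul] at h
  simpa [mulVec, dotProduct] using h

/-- kernel: `|e^a + e^{−a} − 2| ≤ 2a²` for `|a| ≤ 1`. [folklore] -/
private theorem exp_add_exp_neg_sub_two_le {a : ℝ} (ha : |a| ≤ 1) : |Real.exp a + Real.exp (-a) - 2| ≤ 2 * a ^ 2 := by
  have h1 := Real.abs_exp_sub_one_sub_id_le ha
  have h2 := Real.abs_exp_sub_one_sub_id_le (show |(-a)| ≤ 1 by rwa [abs_neg])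
  have e : Real.exp a + Real.exp (-a) - 2 = (Real.exp a - 1 - a) + (Real.exp (-a) - 1 - (-a)) := by ring
  rw [e]
  refine (abs_add_le _ _).trans ?_
  rw [neg_sq] at h2
  linarith

/-- kernel: `(e^a − 1)² ≤ 4a²` for `|a| ≤ 1`. [folklore] -/
private theorem sq_exp_sub_one_le {a : ℝ} (ha : |a| ≤ 1) : (Real.exp a - 1) ^ 2 ≤ 4 * a ^ 2 := by
  have h := Real.abs_exp_sub_one_le ha
  have h' : |Real.exp a - 1| ^ 2 ≤ (2 * |a|) ^ 2 := pow_le_pow_left₀ (abs_nonneg _) h 2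
  rw [sq_abs, mul_pow, sq_abs] at h'
  linarith

set_option maxHeartbeats 800000 in
/-- **THE WEIGHTED `ℓ²` (DAVIES) STEP**: for a weight `ψ` with `|ψ(b₊) − ψ(b₋)| ≤ τ ≤ 1` on the bonds of `Ω*` and every `g`,
`‖P_ψg‖₂² ≤ (1 + τ²)‖g‖₂² − (8D)⁻¹E_Ω(g)`, `(P_ψg)(z) = Σ_y e^{ψ(z)−ψ(y)}P(z,y)g(y)`, `E_Ω(g) = Σ_{b∈Ω*}(g(b₊) − g(b₋))²` — the discrete form
of Davies' perturbation: in `‖P_ψg‖² = ‖g‖² − 2θ g·L_ψg + θ²‖L_ψg‖²` (`θ = (8D)⁻¹`, `L_ψ = e^ψ(−Δ^N_Ω)e^{−ψ}`) the first-order terms cancel,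
`g·L_ψg = Σ_b[(g(b₊)−g(b₋))² − g(b₊)g(b₋)(e^Δ + e^{−Δ} − 2)] ≥ E_Ω(g) − 2Dτ²‖g‖²` and `‖L_ψg‖² ≤ 8D·E_Ω(g) + 32D²τ²‖g‖²`
(`|e^x − 1 − x| ≤ x²`, `|e^x − 1| ≤ 2|x|`).  The energy input of the Nash–Davies iteration (file 3); the `ℓ²` analogue of the lineage's
Agmon/Combes–Thomas bounds. [cite: BalabanImbrieJaffe1985, (7.3.2) p.326] -/
theorem davies_step (Ω : Finset (Balaban1983to89.Site P 0)) {ψ : Balaban1983to89.Site P 0 → ℝ} {τ : ℝ} (hτ : τ ≤ 1)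
    (hψ : ∀ b ∈ starB Ω, |ψ b.tgt - ψ b.src| ≤ τ) (g : Balaban1983to89.Site P 0 → ℝ) :
    ∑ z, (∑ y, Real.exp (ψ z - ψ y) *
        ((1 : Matrix (Balaban1983to89.Site P 0) (Balaban1983to89.Site P 0) ℝ) - (8 * (P.d : ℝ))⁻¹ • lapN Ω) z y * g y) ^ 2 ≤
      (1 + τ ^ 2) * ∑ y, g y ^ 2 - (8 * (P.d : ℝ))⁻¹ * ∑ b ∈ starB Ω, (g b.tgt - g b.src) ^ 2 := by
  have hD : (1 : ℝ) ≤ P.d := by exact_mod_cast P.hd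
  have hDpos : (0 : ℝ) < P.d := by linarith
  set θ : ℝ := (8 * (P.d : ℝ))⁻¹ with hθ
  have hθpos : 0 < θ := by positivity
  have hθD : θ * (8 * P.d) = 1 := by rw [hθ]; exact inv_mul_cancel₀ (by positivity)
  set N : ℝ := ∑ y, g y ^ 2 with hN
  set E : ℝ := ∑ b ∈ starB Ω, (g b.tgt - g b.src) ^ 2 with hE
  have hNnn : 0 ≤ N := sum_nonneg fun _ _ => sq_nonneg _
  have hEnn : 0 ≤ E := sum_nonneg fun _ _ => sq_nonneg _
  -- the bond coefficients `c_b(z) = e^{ψ(z)−ψ(b₊)}g(b₊) − e^{ψ(z)−ψ(b₋)}g(b₋)` and `ℓ = L_ψg`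
  set c : PBond P 0 → Balaban1983to89.Site P 0 → ℝ :=
    fun b z => Real.exp (ψ z - ψ b.tgt) * g b.tgt - Real.exp (ψ z - ψ b.src) * g b.src with hc
  set ℓ : Balaban1983to89.Site P 0 → ℝ := fun z => ∑ b ∈ starB Ω, bvec b z * c b z with hℓ
  have hh : ∀ z, ∑ y, Real.exp (ψ z - ψ y) *
      ((1 : Matrix (Balaban1983to89.Site P 0) (Balaban1983to89.Site P 0) ℝ) - (8 * (P.d : ℝ))⁻¹ • lapN Ω) z y * g y = g z - θ * ℓ z :=
    fun z => cwalk_apply Ω ψ g z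
  -- the bond facts: `|Δ_b| ≤ τ ≤ 1`
  have hΔ1 : ∀ b ∈ starB Ω, |ψ b.tgt - ψ b.src| ≤ 1 := fun b hb => (hψ b hb).trans hτ
  have hΔsq : ∀ b ∈ starB Ω, (ψ b.tgt - ψ b.src) ^ 2 ≤ τ ^ 2 := fun b hb => by
    have h := hψ b hb
    have h0 : 0 ≤ τ := (abs_nonneg _).trans h
    nlinarith [abs_nonneg (ψ b.tgt - ψ b.src), sq_abs (ψ b.tgt - ψ b.src)]
  -- STEP (b): expand the square
  have eL : ∑ z, (∑ y, Real.exp (ψ z - ψ y) *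
      ((1 : Matrix (Balaban1983to89.Site P 0) (Balaban1983to89.Site P 0) ℝ) - (8 * (P.d : ℝ))⁻¹ • lapN Ω) z y * g y) ^ 2 =
      N - 2 * θ * ∑ z, g z * ℓ z + θ ^ 2 * ∑ z, ℓ z ^ 2 := by
    simp_rw [hh]
    have e : ∀ z, (g z - θ * ℓ z) ^ 2 = g z ^ 2 - 2 * θ * (g z * ℓ z) + θ ^ 2 * ℓ z ^ 2 := fun z => by ring
    simp_rw [e]
    rw [sum_add_distrib, sum_sub_distrib, ← mul_sum, ← mul_sum]
  -- STEP (c): the cross term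
  have hc_t : ∀ b : PBond P 0, c b b.tgt = g b.tgt - Real.exp (ψ b.tgt - ψ b.src) * g b.src := fun b => by
    simp only [hc, sub_self, Real.exp_zero, one_mul]
  have hc_s : ∀ b : PBond P 0, c b b.src = Real.exp (ψ b.src - ψ b.tgt) * g b.tgt - g b.src := fun b => by
    simp only [hc, sub_self, Real.exp_zero, one_mul]
  have hcross : ∑ z, g z * ℓ z = ∑ b ∈ starB Ω, ((g b.tgt - g b.src) ^ 2 -
      g b.tgt * g b.src * (Real.exp (ψ b.tgt - ψ b.src) + Real.exp (ψ b.src - ψ b.tgt) - 2)) := by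
    have e1 : ∑ z, g z * ℓ z = ∑ z, ∑ b ∈ starB Ω, bvec b z * (g z * c b z) := by
      refine sum_congr rfl fun z _ => ?_
      rw [hℓ, mul_sum]; exact sum_congr rfl fun b _ => by ring
    rw [e1, Finset.sum_comm]
    refine sum_congr rfl fun b _ => ?_
    rw [sum_bvec_mul b (fun z => g z * c b z), hc_t, hc_s]
    ring
  have hcross_ge : E - τ ^ 2 * (2 * P.d * N) ≤ ∑ z, g z * ℓ z := by
    rw [hcross]
    have hpt : ∀ b ∈ starB Ω, (g b.tgt - g b.src) ^ 2 - τ ^ 2 * (g b.tgt ^ 2 + g b.src ^ 2) ≤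
        (g b.tgt - g b.src) ^ 2 - g b.tgt * g b.src * (Real.exp (ψ b.tgt - ψ b.src) + Real.exp (ψ b.src - ψ b.tgt) - 2) := by
      intro b hb
      have hA : |Real.exp (ψ b.tgt - ψ b.src) + Real.exp (ψ b.src - ψ b.tgt) - 2| ≤ 2 * (ψ b.tgt - ψ b.src) ^ 2 := by
        have h := exp_add_exp_neg_sub_two_le (hΔ1 b hb)
        rwa [show -(ψ b.tgt - ψ b.src) = ψ b.src - ψ b.tgt by ring] at h
      have hA' : |Real.exp (ψ b.tgt - ψ b.src) + Real.exp (ψ b.src - ψ b.tgt) - 2| ≤ 2 * τ ^ 2 :=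
        hA.trans (by linarith [hΔsq b hb])
      have hgg : |g b.tgt * g b.src| ≤ (g b.tgt ^ 2 + g b.src ^ 2) / 2 := by
        rw [abs_le]; constructor <;> nlinarith [sq_nonneg (g b.tgt - g b.src), sq_nonneg (g b.tgt + g b.src)]
      have hprod : g b.tgt * g b.src * (Real.exp (ψ b.tgt - ψ b.src) + Real.exp (ψ b.src - ψ b.tgt) - 2) ≤
          τ ^ 2 * (g b.tgt ^ 2 + g b.src ^ 2) := by
        refine (le_abs_self _).trans ?_
        rw [abs_mul]
        calc |g b.tgt * g b.src| * |Real.exp (ψ b.tgt - ψ b.src) + Real.exp (ψ b.src - ψ b.tgt) - 2|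
            ≤ (g b.tgt ^ 2 + g b.src ^ 2) / 2 * (2 * τ ^ 2) :=
              mul_le_mul hgg hA' (abs_nonneg _) (by positivity)
          _ = τ ^ 2 * (g b.tgt ^ 2 + g b.src ^ 2) := by ring
      linarith
    have hsum := sum_le_sum hpt
    rw [sum_sub_distrib, ← mul_sum] at hsum
    have hb2 := sum_sq_bond_le Ω g
    have hτ2 : 0 ≤ τ ^ 2 := sq_nonneg _
    have : E - τ ^ 2 * (2 * P.d * N) ≤ E - τ ^ 2 * ∑ b ∈ starB Ω, (g b.tgt ^ 2 + g b.src ^ 2) := by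
      have := mul_le_mul_of_nonneg_left hb2 hτ2; linarith
    exact this.trans hsum
  -- STEP (d): the square term
  have hsq : ∑ z, ℓ z ^ 2 ≤ 8 * P.d * E + 32 * (P.d : ℝ) ^ 2 * τ ^ 2 * N := by
    -- per site: Cauchy–Schwarz over the bonds through `z`
    have hz : ∀ z, ℓ z ^ 2 ≤ 2 * P.d * ∑ b ∈ starB Ω, bvec b z ^ 2 * c b z ^ 2 := by
      intro z
      have e1 : ℓ z = ∑ b ∈ starB Ω, bvec b z ^ 2 * (bvec b z * c b z) := by
        rw [hℓ]; exact sum_congr rfl fun b _ => by rw [← mul_assoc, (bvec_pow_facts b z).2.1]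
      have hcs := sum_mul_sq_le_sq_mul_sq (starB Ω) (fun b => bvec b z ^ 2) (fun b => bvec b z * c b z)
      rw [← e1] at hcs
      have e2 : ∑ b ∈ starB Ω, (bvec b z ^ 2) ^ 2 = ∑ b ∈ starB Ω, bvec b z ^ 2 :=
        sum_congr rfl fun b _ => (bvec_pow_facts b z).2.2
      have e3 : ∑ b ∈ starB Ω, (bvec b z * c b z) ^ 2 = ∑ b ∈ starB Ω, bvec b z ^ 2 * c b z ^ 2 :=
        sum_congr rfl fun b _ => by ring
      rw [e2, e3] at hcs
      have h2D := sum_bvec_sq_le Ω z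
      have hnn : 0 ≤ ∑ b ∈ starB Ω, bvec b z ^ 2 * c b z ^ 2 := sum_nonneg fun b _ => mul_nonneg (sq_nonneg _) (sq_nonneg _)
      exact hcs.trans (mul_le_mul_of_nonneg_right h2D hnn)
    have h1 : ∑ z, ℓ z ^ 2 ≤ 2 * P.d * ∑ b ∈ starB Ω, (c b b.tgt ^ 2 + c b b.src ^ 2) := by
      refine (sum_le_sum fun z _ => hz z).trans ?_
      rw [← mul_sum, Finset.sum_comm]
      refine mul_le_mul_of_nonneg_left (le_of_eq (sum_congr rfl fun b _ => ?_)) (by positivity)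
      exact sum_bvec_sq_mul b (fun z => c b z ^ 2)
    -- the two bond coefficients
    have h2 : ∀ b ∈ starB Ω, c b b.tgt ^ 2 + c b b.src ^ 2 ≤ 4 * (g b.tgt - g b.src) ^ 2 + 8 * τ ^ 2 * (g b.tgt ^ 2 + g b.src ^ 2) := by
      intro b hb
      have hq1 : (Real.exp (ψ b.tgt - ψ b.src) - 1) ^ 2 ≤ 4 * τ ^ 2 :=
        (sq_exp_sub_one_le (hΔ1 b hb)).trans (by linarith [hΔsq b hb])
      have hq2 : (Real.exp (ψ b.src - ψ b.tgt) - 1) ^ 2 ≤ 4 * τ ^ 2 := by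
        have h := sq_exp_sub_one_le (show |(-(ψ b.tgt - ψ b.src))| ≤ 1 by rw [abs_neg]; exact hΔ1 b hb)
        rw [neg_sq, show -(ψ b.tgt - ψ b.src) = ψ b.src - ψ b.tgt by ring] at h
        exact h.trans (by linarith [hΔsq b hb])
      have et : c b b.tgt = (g b.tgt - g b.src) - (Real.exp (ψ b.tgt - ψ b.src) - 1) * g b.src := by rw [hc_t]; ring
      have es : c b b.src = (Real.exp (ψ b.src - ψ b.tgt) - 1) * g b.tgt + (g b.tgt - g b.src) := by rw [hc_s]; ring
      have ht2 : c b b.tgt ^ 2 ≤ 2 * (g b.tgt - g b.src) ^ 2 + 2 * ((Real.exp (ψ b.tgt - ψ b.src) - 1) ^ 2 * g b.src ^ 2) := by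
        rw [et]; nlinarith [sq_nonneg ((g b.tgt - g b.src) + (Real.exp (ψ b.tgt - ψ b.src) - 1) * g b.src)]
      have hs2 : c b b.src ^ 2 ≤ 2 * (g b.tgt - g b.src) ^ 2 + 2 * ((Real.exp (ψ b.src - ψ b.tgt) - 1) ^ 2 * g b.tgt ^ 2) := by
        rw [es]; nlinarith [sq_nonneg ((Real.exp (ψ b.src - ψ b.tgt) - 1) * g b.tgt - (g b.tgt - g b.src))]
      have hm1 : (Real.exp (ψ b.tgt - ψ b.src) - 1) ^ 2 * g b.src ^ 2 ≤ 4 * τ ^ 2 * g b.src ^ 2 :=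
        mul_le_mul_of_nonneg_right hq1 (sq_nonneg _)
      have hm2 : (Real.exp (ψ b.src - ψ b.tgt) - 1) ^ 2 * g b.tgt ^ 2 ≤ 4 * τ ^ 2 * g b.tgt ^ 2 :=
        mul_le_mul_of_nonneg_right hq2 (sq_nonneg _)
      linarith
    have h3 : ∑ b ∈ starB Ω, (c b b.tgt ^ 2 + c b b.src ^ 2) ≤ 4 * E + 8 * τ ^ 2 * ∑ b ∈ starB Ω, (g b.tgt ^ 2 + g b.src ^ 2) := by
      refine (sum_le_sum h2).trans (le_of_eq ?_)
      rw [sum_add_distrib, ← mul_sum, ← mul_sum]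
    have hb2 := sum_sq_bond_le Ω g
    have h4 : 2 * (P.d : ℝ) * ∑ b ∈ starB Ω, (c b b.tgt ^ 2 + c b b.src ^ 2) ≤
        2 * P.d * (4 * E + 8 * τ ^ 2 * (2 * P.d * N)) := by
      refine mul_le_mul_of_nonneg_left ?_ (by positivity)
      have := mul_le_mul_of_nonneg_left hb2 (show 0 ≤ 8 * τ ^ 2 by positivity)
      linarith
    refine h1.trans (h4.trans (le_of_eq ?_))
    ring
  -- STEP (e): assembly
  rw [eL]
  have hθ2 : θ ^ 2 * ∑ z, ℓ z ^ 2 ≤ θ ^ 2 * (8 * P.d * E + 32 * (P.d : ℝ) ^ 2 * τ ^ 2 * N) :=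
    mul_le_mul_of_nonneg_left hsq (sq_nonneg _)
  have hθ1 : -(2 * θ * ∑ z, g z * ℓ z) ≤ -(2 * θ * (E - τ ^ 2 * (2 * P.d * N))) := by
    have := mul_le_mul_of_nonneg_left hcross_ge (show 0 ≤ 2 * θ by positivity); linarith
  have hfin : N - 2 * θ * (E - τ ^ 2 * (2 * P.d * N)) + θ ^ 2 * (8 * P.d * E + 32 * (P.d : ℝ) ^ 2 * τ ^ 2 * N) =
      (1 + τ ^ 2) * N - θ * E := by
    have e8 : θ * P.d = 1 / 8 := by
      have : θ * (8 * P.d) = 8 * (θ * P.d) := by ring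
      linarith [hθD]
    have e1 : 2 * θ * (τ ^ 2 * (2 * P.d * N)) = (4 * (θ * P.d)) * (τ ^ 2 * N) := by ring
    have e2 : θ ^ 2 * (32 * (P.d : ℝ) ^ 2 * τ ^ 2 * N) = 32 * (θ * P.d) ^ 2 * (τ ^ 2 * N) := by ring
    have e3 : θ ^ 2 * (8 * P.d * E) = 8 * (θ * P.d) * (θ * E) := by ring
    have e0 : N - 2 * θ * (E - τ ^ 2 * (2 * P.d * N)) + θ ^ 2 * (8 * P.d * E + 32 * (P.d : ℝ) ^ 2 * τ ^ 2 * N) =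
        N - 2 * θ * E + 2 * θ * (τ ^ 2 * (2 * P.d * N)) + θ ^ 2 * (8 * P.d * E) + θ ^ 2 * (32 * (P.d : ℝ) ^ 2 * τ ^ 2 * N) := by ring
    rw [e0, e1, e2, e3, e8]; ring
  linarith

/-- **THE WEIGHTED `ℓ¹` STEP (identity)**: for `g` supported in `Ω` and a weight `ψ` FLAT ACROSS THE BONDS LEAVING `Ω` (`ψ(y ± e_μ) = ψ(y)`
whenever `y ∈ Ω` and the bond is not in `Ω*`), the total mass of `P_ψg` is
`Σ_z(P_ψg)(z) = Σ_y g(y)(1 + (8D)⁻¹Σ_μ(e^{ψ(y+e_μ)−ψ(y)} + e^{ψ(y−e_μ)−ψ(y)} − 2))` — the drift of the weight along the walk; it is of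
second order in the gradient of `ψ` AT EVERY SITE, the Neumann boundary sites included, exactly because of the flatness (a missing neighbour and
a present one then contribute the same `0`).  The mass input of the Nash–Davies iteration (file 3). [cite: BalabanImbrieJaffe1985, (7.3.2) p.326] -/
theorem ell1_step_eq (Ω : Finset (Balaban1983to89.Site P 0)) (ψ : Balaban1983to89.Site P 0 → ℝ) {g : Balaban1983to89.Site P 0 → ℝ}
    (hg : ∀ y, y ∉ Ω → g y = 0)
    (hflat : ∀ y ∈ Ω, ∀ μ : Fin P.d, ((⟨y, μ⟩ : PBond P 0) ∉ starB Ω → ψ (y.shift μ) = ψ y) ∧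
      ((⟨y.unshift μ, μ⟩ : PBond P 0) ∉ starB Ω → ψ (y.unshift μ) = ψ y)) :
    ∑ z, ∑ y, Real.exp (ψ z - ψ y) * ((1 : Matrix (Balaban1983to89.Site P 0) (Balaban1983to89.Site P 0) ℝ) - (8 * (P.d : ℝ))⁻¹ • lapN Ω) z y * g y =
      ∑ y, g y * (1 + (8 * (P.d : ℝ))⁻¹ * ∑ μ : Fin P.d,
        (Real.exp (ψ (y.shift μ) - ψ y) + Real.exp (ψ (y.unshift μ) - ψ y) - 2)) := by
  rw [Finset.sum_comm]
  refine sum_congr rfl fun y _ => ?_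
  -- the column sum of the conjugated walk at `y`
  have hcol : ∑ z, Real.exp (ψ z - ψ y) *
      ((1 : Matrix (Balaban1983to89.Site P 0) (Balaban1983to89.Site P 0) ℝ) - (8 * (P.d : ℝ))⁻¹ • lapN Ω) z y * g y =
      g y * (1 + (8 * (P.d : ℝ))⁻¹ * ∑ μ : Fin P.d,
        ((if (⟨y.unshift μ, μ⟩ : PBond P 0) ∈ starB Ω then Real.exp (ψ (y.unshift μ) - ψ y) - 1 else 0) +
          (if (⟨y, μ⟩ : PBond P 0) ∈ starB Ω then Real.exp (ψ (y.shift μ) - ψ y) - 1 else 0))) := by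
    simp_rw [walk_apply]
    have e1 : ∀ z, Real.exp (ψ z - ψ y) * ((if z = y then (1 : ℝ) else 0) - (8 * (P.d : ℝ))⁻¹ * ∑ b ∈ starB Ω, bvec b z * bvec b y) * g y
        = (if z = y then Real.exp (ψ z - ψ y) * g y else 0) -
          g y * ((8 * (P.d : ℝ))⁻¹ * ∑ b ∈ starB Ω, bvec b y * (bvec b z * Real.exp (ψ z - ψ y))) := by
      intro z
      have hs : ∑ b ∈ starB Ω, bvec b y * (bvec b z * Real.exp (ψ z - ψ y)) = (∑ b ∈ starB Ω, bvec b z * bvec b y) * Real.exp (ψ z - ψ y) := by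
        rw [Finset.sum_mul]; exact sum_congr rfl fun b _ => by ring
      rw [hs]; split_ifs <;> ring
    simp_rw [e1]
    rw [Finset.sum_sub_distrib, Finset.sum_ite_eq' univ y, if_pos (mem_univ _), sub_self, Real.exp_zero, one_mul, ← mul_sum, ← mul_sum,
      Finset.sum_comm]
    have e2 : ∑ b ∈ starB Ω, ∑ z, bvec b y * (bvec b z * Real.exp (ψ z - ψ y)) =
        ∑ b ∈ starB Ω, bvec b y * (Real.exp (ψ b.tgt - ψ y) - Real.exp (ψ b.src - ψ y)) := by
      refine sum_congr rfl fun b _ => ?_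
      rw [← mul_sum, sum_bvec_mul b (fun z => Real.exp (ψ z - ψ y))]
    rw [e2, sum_starB_bvec_mul Ω (fun b => Real.exp (ψ b.tgt - ψ y) - Real.exp (ψ b.src - ψ y)) y]
    have e3 : ∀ μ : Fin P.d, (⟨y.unshift μ, μ⟩ : PBond P 0).tgt = y := fun μ => (shiftEquiv μ).right_inv y
    have e4 : ∀ μ : Fin P.d, (⟨y, μ⟩ : PBond P 0).tgt = y.shift μ := fun μ => rfl
    simp only [e3, e4, sub_self, Real.exp_zero]
    have e5 : ∀ μ : Fin P.d,
        ((if (⟨y.unshift μ, μ⟩ : PBond P 0) ∈ starB Ω then (1 : ℝ) - Real.exp (ψ (y.unshift μ) - ψ y) else 0) -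
          (if (⟨y, μ⟩ : PBond P 0) ∈ starB Ω then Real.exp (ψ (y.shift μ) - ψ y) - 1 else 0)) =
        -(((if (⟨y.unshift μ, μ⟩ : PBond P 0) ∈ starB Ω then Real.exp (ψ (y.unshift μ) - ψ y) - 1 else 0) +
          (if (⟨y, μ⟩ : PBond P 0) ∈ starB Ω then Real.exp (ψ (y.shift μ) - ψ y) - 1 else 0))) := by
      intro μ; split_ifs <;> ring
    simp_rw [e5]
    rw [sum_neg_distrib]
    ring
  rw [hcol]
  by_cases hy : y ∈ Ω
  · congr 2
    congr 1
    refine sum_congr rfl fun μ _ => ?_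
    have h1 := (hflat y hy μ).1
    have h2 := (hflat y hy μ).2
    by_cases ha : (⟨y.unshift μ, μ⟩ : PBond P 0) ∈ starB Ω <;> by_cases hb : (⟨y, μ⟩ : PBond P 0) ∈ starB Ω
    · rw [if_pos ha, if_pos hb]; ring
    · rw [if_pos ha, if_neg hb, h1 hb, sub_self, Real.exp_zero]; ring
    · rw [if_neg ha, if_pos hb, h2 ha, sub_self, Real.exp_zero]; ring
    · rw [if_neg ha, if_neg hb, h1 hb, h2 ha, sub_self, Real.exp_zero]; ring
  · rw [hg y hy, zero_mul, zero_mul]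

/-- **THE WEIGHTED `ℓ¹` STEP (bound)**: under the hypotheses of `ell1_step_eq`, for `g ≥ 0` and a weight whose one-step drift at the sites of
`Ω` is at most `κ` (`Σ_μ(e^{ψ(y+e_μ)−ψ(y)} + e^{ψ(y−e_μ)−ψ(y)} − 2) ≤ κ` for `y ∈ Ω`), `Σ_z(P_ψg)(z) ≤ (1 + (8D)⁻¹κ)Σ_yg(y)`.
[cite: BalabanImbrieJaffe1985, (7.3.2) p.326] -/
theorem ell1_step_le (Ω : Finset (Balaban1983to89.Site P 0)) (ψ : Balaban1983to89.Site P 0 → ℝ) {g : Balaban1983to89.Site P 0 → ℝ}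
    (hg : ∀ y, y ∉ Ω → g y = 0) (hg0 : ∀ y, 0 ≤ g y)
    (hflat : ∀ y ∈ Ω, ∀ μ : Fin P.d, ((⟨y, μ⟩ : PBond P 0) ∉ starB Ω → ψ (y.shift μ) = ψ y) ∧
      ((⟨y.unshift μ, μ⟩ : PBond P 0) ∉ starB Ω → ψ (y.unshift μ) = ψ y))
    {κ : ℝ} (hκ : ∀ y ∈ Ω, ∑ μ : Fin P.d, (Real.exp (ψ (y.shift μ) - ψ y) + Real.exp (ψ (y.unshift μ) - ψ y) - 2) ≤ κ) :
    ∑ z, ∑ y, Real.exp (ψ z - ψ y) * ((1 : Matrix (Balaban1983to89.Site P 0) (Balaban1983to89.Site P 0) ℝ) - (8 * (P.d : ℝ))⁻¹ • lapN Ω) z y * g y ≤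
      (1 + (8 * (P.d : ℝ))⁻¹ * κ) * ∑ y, g y := by
  have hD : (1 : ℝ) ≤ P.d := by exact_mod_cast P.hd
  rw [ell1_step_eq Ω ψ hg hflat, mul_sum]
  refine sum_le_sum fun y _ => ?_
  by_cases hy : y ∈ Ω
  · rw [mul_comm]
    exact mul_le_mul_of_nonneg_right (by linarith [mul_le_mul_of_nonneg_left (hκ y hy) (show 0 ≤ (8 * (P.d : ℝ))⁻¹ by positivity)])
      (hg0 y)
  · rw [hg y hy, zero_mul, mul_zero]

end Walk

end

end Literature.MathematicalPhysics.QuantumFieldTheory.BalabanImbrieJaffe1984to88.BIJ88FreeNeumannLaplacianRegion
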